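import Literature.NumberTheory.Rogawski1990.RankOneUnstableTransferNonsplitCMOfCore     -- ★ p843033 A-p19 (g22): `compactSpace_centralizer_H_of_frame`, `normOne_frame_of_mem_centralizer`; brings ★ `finCharpolyTwo_eq_of_frame`
import Literature.NumberTheory.Rogawski1990.RegularOrbitalIntegralLocallyConstantCM     -- ★ F0P3a-p03 (g10): `isOpen_setOf_isRegularElt_local_of_nonsplit`, `centralizer_eq_centralizer_of_isRegularElt_local_of_nonsplit`
import Literature.NumberTheory.Automorphic.OrbitalIntegralSupportLocalisation           -- ★ p843029 A-p16 (g27): `isCompact_setOf_conj_mem_of_isClosed`; brings ★ `exists_nhds_forall_conj_eq_of_isLocallyConstant` (tube lemma)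
import Literature.NumberTheory.Automorphic.LocalEndoscopicOrbitClosed                   -- ★ `setOf_conj_prod_eq`, `isClosed_conjClass_local_of_isRegularElt`
import Literature.NumberTheory.Automorphic.ConjugationProperOnRegularCompacta           -- ★ A-p03: `GL.exists_isCompact_forall_conj_mem_of_charpoly_separable` (Harish-Chandra's straightening)
import Literature.NumberTheory.Automorphic.OrbitalMeasureCanonicalExistsCM               -- ★ `charpoly_separable_localNonsplitEquiv_of_isRegularElt`
import HarnessLib

/-!
# Plain orbital integrals `∫ f(h t h⁻¹) dν(h)` on `H_v = U(Φ₂)(L⁺_v) × U(Φ₁)(L⁺_v)` are LOCALLY CONSTANT along an elliptic torus at its `H`-regular points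
# (Harish-Chandra's uniform compactness, read at compact centralisers; road «R1LL-tree», architect A-p16 (g27) RULING A-9 (b4) `hreg`)

Topic `NumberTheory/Rogawski1990`; namespace `Literature.NumberTheory.Rogawski1990`.  THEOREMS ONLY (no definition, no instance, no notation, no named fact, no `sorry`).
Cell `pub/hodgecm-mathlib` (D-0151), crux H413 = `stmt-HodgeConjecture-24833`, line «N6nsGerm» stub `stub_N6nsR1LL : RankOneUnstableTransferNonsplitCME`; road «R1LL-tree»
(LEAD F0P3a-plan (g10) WORD T9-8 (A); architect A-p16 (g27) RULING A-9 (b4)); hand = A-p19 (g22).  FILE A of the (b4) discharge: the ORBITAL half of the `hreg` binder of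
★ F0P3-p01 (g13)'s `forall_exists_eventually_mul_eq_const_of_depthExpansion` (LAYER 2a, p843155); FILE B (`RankOneTorusRegularLocalConstancy`) adds the factor `Δ` and the head.

THE MATHEMATICS [HarishChandra1970, Part I §3 Lemmas 13–14, 19–21; Rogawski1990 §4.9 p. 54].  `t₀ ∈ H_v` with `t₀.1` regular semisimple and an ELLIPTIC eigenframe
`t₀.1·P = P·diag(d)`, `σ(dᵢ)dᵢ = 1`; `C = Z(t₀)` is then a compact torus (★ `compactSpace_centralizer_H_of_frame`).  For `f` locally constant with compact support and `s ∈ C`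
with `s.1` regular:  **`t ↦ ∫_{H_v} f(h t h⁻¹) dν(h)` is constant on a neighbourhood of `s` in `C`** (any measure `ν`; the integrand family is even pointwise eventually constant).
Proof: (§1, generic) if the orbit map of `s` is proper and the support can be STRAIGHTENED — one compact `D` with `h t h⁻¹ ∈ tsupport f ⇒ h s h⁻¹ ∈ D` for `t` near `s` —
then on the compact `B = {h | h s h⁻¹ ∈ D}` the tube lemma (★ `exists_nhds_forall_conj_eq_of_isLocallyConstant`) freezes `f(h t h⁻¹)`, and off `B` both integrands vanish;
(§2) on `H_v`: the class of an `H`-regular element is closed (★ `setOf_conj_prod_eq` × ★ `isClosed_conjClass_local_of_isRegularElt`), its centraliser is compact (★ p843033), so the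
orbit map is proper (★ `isCompact_setOf_conj_mem_of_isClosed`); the straightening is Harish-Chandra's `s.1 = Σ_k a_k(t.1)·t.1^k` in the one-place model `U(σ_w, Φ₂,w)(L_w) ≤
GL₂(L_w)` (★ `GL.exists_isCompact_forall_conj_mem_of_charpoly_separable` through ★ `localNonsplitEquiv`), times the compact factor `U(Φ₁)_v`.
A transported form (`h ↦ e.symm h` inside, `e : H_v ≃ₜ* H_v`) serves the stable partner `t ↦ e t` of the road's (τ) brick (F0P2-p01 (g10), A-8 (b)).

* §1 `eventually_integral_conj_eq_of_straightening` (generic topological group, any measure, any reparametrisation `φ` of the conjugating variable).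
* §2 `isClosed_conjClass_localH_of_isRegularElt_fst`, `compactSpace_centralizer_of_mem_centralizer_of_isRegularElt`, `isCompact_setOf_conj_mem_of_mem_centralizer_of_isRegularElt`
  (properness), `exists_isCompact_forall_eventually_conj_mem` (straightening), **`eventually_integral_conj_comp_eq_of_mem_centralizer`**, **`eventually_integral_conj_eq_of_mem_centralizer`**,
  **`eventually_integral_conj_mulEquiv_eq_of_mem_centralizer`**.
HONEST LABEL: HC_CM is proved only modulo the printed citations (2 remaining named inputs hLiu418, h413) until rung 0 closes; this file is harmonic analysis on `H_v`, no transfer.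

## References
* [HarishChandra1970] Harish-Chandra (notes by G. van Dijk), *Harmonic Analysis on Reductive p-adic Groups*, LNM 162 (1970), Part I §3, Lemmas 13–14 and 19–21.
* [Rogawski1990] J. D. Rogawski, *Automorphic Representations of Unitary Groups in Three Variables*, Ann. of Math. Stud. 123 (1990), §4.9 p. 54; §4.3 (4.3.1) p. 43; §3.1 p. 19.
* [DeitmarEchterhoff2014] A. Deitmar, S. Echterhoff, *Principles of Harmonic Analysis*, 2nd ed. (2014), Lemma 9.3.3 (closed orbits ⇒ proper orbit maps).
-/

set_option autoImplicit false

noncomputable section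

open Set Filter Topology MeasureTheory NumberField IsDedekindDomain Polynomial
open scoped Matrix MatrixGroups Pointwise

namespace Literature.NumberTheory.Rogawski1990

open Literature.NumberTheory.Automorphic Literature.NumberTheory.Automorphic.UnitaryGroup Literature.NumberTheory.GaloisRepresentations
open Literature.MeasureTheory.Group

/-! ## §1 Generic: a plain orbital integral is eventually constant along a family that can be straightened at a point with proper orbit map -/

section Generic

variable {G : Type*} [Group G] [TopologicalSpace G] [IsTopologicalGroup G]
  {Ω : Type*} [MeasurableSpace Ω] {V : Type*} [NormedAddCommGroup V] [NormedSpace ℝ V]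

/-- **Harish-Chandra's local constancy, abstract form.**  `f : G → V` locally constant, `ι : X → G` continuous, `s : X`; suppose one compact `D ⊆ G` STRAIGHTENS the
support near `s` — `f(h·ι x·h⁻¹) ≠ 0 ⇒ h·ι s·h⁻¹ ∈ D` for `x` near `s` — and `B = {h | h·ι s·h⁻¹ ∈ D}` is compact (the orbit map of `ι s` is proper).  Then for EVERY measure
`ν` on any `Ω` and every `φ : Ω → G`, `x ↦ ∫ f(φ ω · ι x · (φ ω)⁻¹) dν(ω)` is constant near `s`: on `B` the tube lemma freezes the integrand, off `B` it vanishes at `x` and at `s`.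
[cite: HarishChandra1970, Part I §3 Lemmas 14, 20] [cite: Rogawski1990, §4.9 p. 54] -/
theorem eventually_integral_conj_eq_of_straightening (ν : Measure Ω) (φ : Ω → G) {f : G → V} (hf : IsLocallyConstant f)
    {X : Type*} [TopologicalSpace X] {ι : X → G} (hι : Continuous ι) (s : X) {D : Set G}
    (hB : IsCompact {h : G | h * ι s * h⁻¹ ∈ D})
    (hD : ∀ᶠ x in 𝓝 s, ∀ h : G, f (h * ι x * h⁻¹) ≠ 0 → h * ι s * h⁻¹ ∈ D) :
    ∀ᶠ x in 𝓝 s, ∫ ω, f (φ ω * ι x * (φ ω)⁻¹) ∂ν = ∫ ω, f (φ ω * ι s * (φ ω)⁻¹) ∂ν := by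
  obtain ⟨U, hU, hUB⟩ := exists_nhds_forall_conj_eq_of_isLocallyConstant hf hB (ι s)
  have hsD : ∀ h : G, f (h * ι s * h⁻¹) ≠ 0 → h * ι s * h⁻¹ ∈ D := hD.self_of_nhds
  filter_upwards [hD, hι.continuousAt.preimage_mem_nhds hU] with x hxD hxU
  refine integral_congr_ae (Eventually.of_forall fun ω => ?_)
  by_cases hh : φ ω * ι s * (φ ω)⁻¹ ∈ D
  · exact hUB (φ ω) hh (ι x) hxU
  · have h1 : f (φ ω * ι x * (φ ω)⁻¹) = 0 := not_not.1 fun hne => hh (hxD (φ ω) hne)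
    have h2 : f (φ ω * ι s * (φ ω)⁻¹) = 0 := not_not.1 fun hne => hh (hsD (φ ω) hne)
    simp only [h1, h2]

end Generic

/-! ## §2 `H_v = U(Φ₂)(L⁺_v) × U(Φ₁)(L⁺_v)` at a non-split place: properness at `H`-regular torus points, straightening, local constancy -/

section LocalH

variable (L : Type) [Field L] [NumberField L] [IsCMField L] (v : HeightOneSpectrum (𝓞 ↥(maximalRealSubfield L)))

/-- Two roots of a separable `(X − a)(X − b)` are distinct. [folklore] -/
private theorem ne_of_separable_X_sub_C_mul₄ {K : Type*} [Field K] {a b : K} (h : ((X - C a) * (X - C b)).Separable) : a ≠ b := by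
  rintro rfl
  exact Polynomial.not_isUnit_X_sub_C a (isCoprime_self.1 h.isCoprime)

/-- `![a, b]` is injective when `a ≠ b`. [folklore] -/
private theorem injective_vecCons_two₄ {K : Type*} {a b : K} (h : a ≠ b) : Function.Injective ![a, b] := by
  intro i j hij
  fin_cases i <;> fin_cases j
  · rfl
  · exact absurd hij h
  · exact absurd hij.symm h
  · rfl

/-- **The conjugacy class of an `H`-REGULAR element of `H_v` is closed** (`= class(γ.1) ×ˢ {γ.2}`: ★ `setOf_conj_prod_eq`, ★ `isClosed_conjClass_local_of_isRegularElt` on `U(Φ₂)_v`;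
the `G`-regular case is ★ `isClosed_conjClass_localH_of_isLocalGRegular`). [cite: Rogawski1990, §3.1 p. 19; §4.9 p. 54] [cite: DeitmarEchterhoff2014, Lemma 9.3.3] -/
theorem isClosed_conjClass_localH_of_isRegularElt_fst (γH : ((cmDatum L 2 (Matrix.of fun i j : Fin 2 => if i.val + j.val + 1 = 2 then (1 : L) else 0)).Local v × (cmDatum L 1 (Matrix.of fun i j : Fin 1 => if i.val + j.val + 1 = 1 then (1 : L) else 0)).Local v)) (hγ : IsRegularElt (γH.1.val : GL (Fin 2) (LocalRing L v))) :
    IsClosed {x : ((cmDatum L 2 (Matrix.of fun i j : Fin 2 => if i.val + j.val + 1 = 2 then (1 : L) else 0)).Local v × (cmDatum L 1 (Matrix.of fun i j : Fin 1 => if i.val + j.val + 1 = 1 then (1 : L) else 0)).Local v) | ∃ y : ((cmDatum L 2 (Matrix.of fun i j : Fin 2 => if i.val + j.val + 1 = 2 then (1 : L) else 0)).Local v × (cmDatum L 1 (Matrix.of fun i j : Fin 1 => if i.val + j.val + 1 = 1 then (1 : L) else 0)).Local v), y * γH * y⁻¹ = x} := by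
  have h := setOf_conj_prod_eq (conjLocal L (IsCMField.complexConj L) v)
    ((adelicForm L 2 (Matrix.of fun i j : Fin 2 => if i.val + j.val + 1 = 2 then (1 : L) else 0)).map (adeleToLocal L v)) ((adelicForm L 1 (Matrix.of fun i j : Fin 1 => if i.val + j.val + 1 = 1 then (1 : L) else 0)).map (adeleToLocal L v)) γH
  have h' : {x : ((cmDatum L 2 (Matrix.of fun i j : Fin 2 => if i.val + j.val + 1 = 2 then (1 : L) else 0)).Local v × (cmDatum L 1 (Matrix.of fun i j : Fin 1 => if i.val + j.val + 1 = 1 then (1 : L) else 0)).Local v) | ∃ y : ((cmDatum L 2 (Matrix.of fun i j : Fin 2 => if i.val + j.val + 1 = 2 then (1 : L) else 0)).Local v × (cmDatum L 1 (Matrix.of fun i j : Fin 1 => if i.val + j.val + 1 = 1 then (1 : L) else 0)).Local v), y * γH * y⁻¹ = x} = {x₁ : ((cmDatum L 2 (Matrix.of fun i j : Fin 2 => if i.val + j.val + 1 = 2 then (1 : L) else 0)).Local v) | ∃ y₁ : ((cmDatum L 2 (Matrix.of fun i j : Fin 2 => if i.val + j.val + 1 = 2 then (1 : L) else 0)).Local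 v), y₁ * γH.1 * y₁⁻¹ = x₁} ×ˢ {γH.2} := h
  rw [h']
  exact (isClosed_conjClass_local_of_isRegularElt L 2 (Matrix.of fun i j : Fin 2 => if i.val + j.val + 1 = 2 then (1 : L) else 0) v (antidiagOne_isHermitian L 2) (isUnit_antidiagOne_det L 2).ne_zero γH.1 hγ).prod isClosed_singleton

variable (w : PlacesOver L v) (hw : IsCMField.complexConj L • w.1 = w.1)

include hw

/-- **Every `H`-regular element of an elliptic torus `Z(t₀)` has compact centraliser** (its own norm-one eigenframe ★ `normOne_frame_of_mem_centralizer`, distinct eigenvalues by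
regularity, ★ `compactSpace_centralizer_H_of_frame`). [cite: Rogawski1990, §3.6 pp. 31–32] -/
theorem compactSpace_centralizer_of_mem_centralizer_of_isRegularElt
    (t₀ : ((cmDatum L 2 (Matrix.of fun i j : Fin 2 => if i.val + j.val + 1 = 2 then (1 : L) else 0)).Local v × (cmDatum L 1 (Matrix.of fun i j : Fin 1 => if i.val + j.val + 1 = 1 then (1 : L) else 0)).Local v)) (P : GL (Fin 2) (LocalRing L v)) (d : Fin 2 → (LocalRing L v)) (ht₀ : IsRegularElt (t₀.1.val : GL (Fin 2) (LocalRing L v)))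
    (hP : (t₀.1.val.val : Matrix (Fin 2) (Fin 2) (LocalRing L v)) * P.val = P.val * Matrix.diagonal d) (hd1 : ∀ i, conjLocal L (IsCMField.complexConj L) v (d i) * d i = 1)
    (t : ((cmDatum L 2 (Matrix.of fun i j : Fin 2 => if i.val + j.val + 1 = 2 then (1 : L) else 0)).Local v × (cmDatum L 1 (Matrix.of fun i j : Fin 1 => if i.val + j.val + 1 = 1 then (1 : L) else 0)).Local v)) (ht : t ∈ Subgroup.centralizer ({t₀} : Set ((cmDatum L 2 (Matrix.of fun i j : Fin 2 => if i.val + j.val + 1 = 2 then (1 : L) else 0)).Local v × (cmDatum L 1 (Matrix.of fun i j : Fin 1 => if i.val + j.val + 1 = 1 then (1 : L) else 0)).Local v))) (hreg : IsRegularElt (t.1.val : GL (Fin 2) (LocalRing L v))) :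
    CompactSpace ↥(Subgroup.centralizer ({t} : Set ((cmDatum L 2 (Matrix.of fun i j : Fin 2 => if i.val + j.val + 1 = 2 then (1 : L) else 0)).Local v × (cmDatum L 1 (Matrix.of fun i j : Fin 1 => if i.val + j.val + 1 = 1 then (1 : L) else 0)).Local v))) := by
  classical
  letI : Field (LocalRing L v) := (LocalRing.isField_of_smul_eq (IsCMField.complexConj L) (IsCMField.complexConj_ne_one L) w hw).toField
  obtain ⟨hn1, hframe⟩ := normOne_frame_of_mem_centralizer L v w hw t₀ P d ht₀ hP hd1 t ht
  have h01 : ((P⁻¹).val * (t.1.val.val : Matrix (Fin 2) (Fin 2) (LocalRing L v)) * P.val) 0 0 ≠ ((P⁻¹).val * (t.1.val.val : Matrix (Fin 2) (Fin 2) (LocalRing L v)) * P.val) 1 1 := by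
    have hsep : (finCharpolyTwo L v t).Separable := hreg
    rw [finCharpolyTwo_eq_of_frame P hframe] at hsep
    exact ne_of_separable_X_sub_C_mul₄ hsep
  exact compactSpace_centralizer_H_of_frame L v w hw t P _ hframe (injective_vecCons_two₄ h01) hn1

/-- **PROPERNESS: the orbit map `h ↦ h t h⁻¹` of an `H`-regular element `t` of an elliptic torus is proper** — `{h | h t h⁻¹ ∈ Q}` is compact for compact `Q` (closed class,
compact centraliser, ★ `isCompact_setOf_conj_mem_of_isClosed`). [cite: DeitmarEchterhoff2014, Lemma 9.3.3] [cite: Rogawski1990, §4.9 p. 54] -/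
theorem isCompact_setOf_conj_mem_of_mem_centralizer_of_isRegularElt
    (t₀ : ((cmDatum L 2 (Matrix.of fun i j : Fin 2 => if i.val + j.val + 1 = 2 then (1 : L) else 0)).Local v × (cmDatum L 1 (Matrix.of fun i j : Fin 1 => if i.val + j.val + 1 = 1 then (1 : L) else 0)).Local v)) (P : GL (Fin 2) (LocalRing L v)) (d : Fin 2 → (LocalRing L v)) (ht₀ : IsRegularElt (t₀.1.val : GL (Fin 2) (LocalRing L v)))
    (hP : (t₀.1.val.val : Matrix (Fin 2) (Fin 2) (LocalRing L v)) * P.val = P.val * Matrix.diagonal d) (hd1 : ∀ i, conjLocal L (IsCMField.complexConj L) v (d i) * d i = 1)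
    (t : ((cmDatum L 2 (Matrix.of fun i j : Fin 2 => if i.val + j.val + 1 = 2 then (1 : L) else 0)).Local v × (cmDatum L 1 (Matrix.of fun i j : Fin 1 => if i.val + j.val + 1 = 1 then (1 : L) else 0)).Local v)) (ht : t ∈ Subgroup.centralizer ({t₀} : Set ((cmDatum L 2 (Matrix.of fun i j : Fin 2 => if i.val + j.val + 1 = 2 then (1 : L) else 0)).Local v × (cmDatum L 1 (Matrix.of fun i j : Fin 1 => if i.val + j.val + 1 = 1 then (1 : L) else 0)).Local v))) (hreg : IsRegularElt (t.1.val : GL (Fin 2) (LocalRing L v)))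
    {Q : Set ((cmDatum L 2 (Matrix.of fun i j : Fin 2 => if i.val + j.val + 1 = 2 then (1 : L) else 0)).Local v × (cmDatum L 1 (Matrix.of fun i j : Fin 1 => if i.val + j.val + 1 = 1 then (1 : L) else 0)).Local v)} (hQ : IsCompact Q) : IsCompact {h : ((cmDatum L 2 (Matrix.of fun i j : Fin 2 => if i.val + j.val + 1 = 2 then (1 : L) else 0)).Local v × (cmDatum L 1 (Matrix.of fun i j : Fin 1 => if i.val + j.val + 1 = 1 then (1 : L) else 0)).Local v) | h * t * h⁻¹ ∈ Q} := by
  haveI := compactSpace_centralizer_of_mem_centralizer_of_isRegularElt L v w hw t₀ P d ht₀ hP hd1 t ht hreg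
  exact isCompact_setOf_conj_mem_of_isClosed t (isClosed_conjClass_localH_of_isRegularElt_fst L v t hreg)
    (isCompact_iff_compactSpace.2 ‹CompactSpace ↥(Subgroup.centralizer ({t} : Set ((cmDatum L 2 (Matrix.of fun i j : Fin 2 => if i.val + j.val + 1 = 2 then (1 : L) else 0)).Local v × (cmDatum L 1 (Matrix.of fun i j : Fin 1 => if i.val + j.val + 1 = 1 then (1 : L) else 0)).Local v)))›) hQ

/-- **STRAIGHTENING along a regular torus at an `H`-regular point** (Harish-Chandra; no ellipticity needed): for `t₀.1` regular, `s ∈ Z(t₀)` with `s.1` regular and a compact `C ⊆ H_v`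
there is ONE compact `D ⊆ H_v` with
`h t h⁻¹ ∈ C ⇒ h s h⁻¹ ∈ D` for all `h` and all `t ∈ Z(t₀)` near `s`.  (In the one-place model `U(σ_w, Φ₂,w)(L_w) ≤ GL₂(L_w)`: `s.1 = Σ_k a_k(t.1) t.1^k` with `a` continuous on the
regular elements commuting with `s.1` — ★ `GL.exists_isCompact_forall_conj_mem_of_charpoly_separable` on a compact regular neighbourhood of `s` in the torus; the `U(Φ₁)_v` factor is compact.)
[cite: HarishChandra1970, Part I §3 Lemmas 13–14] [cite: Rogawski1990, §4.9 p. 54; §3.1 p. 19] -/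
theorem exists_isCompact_forall_eventually_conj_mem
    (t₀ : ((cmDatum L 2 (Matrix.of fun i j : Fin 2 => if i.val + j.val + 1 = 2 then (1 : L) else 0)).Local v × (cmDatum L 1 (Matrix.of fun i j : Fin 1 => if i.val + j.val + 1 = 1 then (1 : L) else 0)).Local v)) (ht₀ : IsRegularElt (t₀.1.val : GL (Fin 2) (LocalRing L v)))
    (s : ↥(Subgroup.centralizer ({t₀} : Set ((cmDatum L 2 (Matrix.of fun i j : Fin 2 => if i.val + j.val + 1 = 2 then (1 : L) else 0)).Local v × (cmDatum L 1 (Matrix.of fun i j : Fin 1 => if i.val + j.val + 1 = 1 then (1 : L) else 0)).Local v)))) (hs : IsRegularElt ((s : ((cmDatum L 2 (Matrix.of fun i j : Fin 2 => if i.val + j.val + 1 = 2 then (1 : L) else 0)).Local v × (cmDatum L 1 (Matrix.of fun i j : Fin 1 => if i.val + j.val + 1 = 1 then (1 : L) else 0)).Local v)).1.val : GL (Fin 2) (LocalRing L v)))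
    {C : Set ((cmDatum L 2 (Matrix.of fun i j : Fin 2 => if i.val + j.val + 1 = 2 then (1 : L) else 0)).Local v × (cmDatum L 1 (Matrix.of fun i j : Fin 1 => if i.val + j.val + 1 = 1 then (1 : L) else 0)).Local v)} (hC : IsCompact C) :
    ∃ D : Set ((cmDatum L 2 (Matrix.of fun i j : Fin 2 => if i.val + j.val + 1 = 2 then (1 : L) else 0)).Local v × (cmDatum L 1 (Matrix.of fun i j : Fin 1 => if i.val + j.val + 1 = 1 then (1 : L) else 0)).Local v), IsCompact D ∧ ∀ᶠ x : ↥(Subgroup.centralizer ({t₀} : Set ((cmDatum L 2 (Matrix.of fun i j : Fin 2 => if i.val + j.val + 1 = 2 then (1 : L) else 0)).Local v × (cmDatum L 1 (Matrix.of fun i j : Fin 1 => if i.val + j.val + 1 = 1 then (1 : L) else 0)).Local v))) in 𝓝 s,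
      ∀ h : ((cmDatum L 2 (Matrix.of fun i j : Fin 2 => if i.val + j.val + 1 = 2 then (1 : L) else 0)).Local v × (cmDatum L 1 (Matrix.of fun i j : Fin 1 => if i.val + j.val + 1 = 1 then (1 : L) else 0)).Local v), h * (x : ((cmDatum L 2 (Matrix.of fun i j : Fin 2 => if i.val + j.val + 1 = 2 then (1 : L) else 0)).Local v × (cmDatum L 1 (Matrix.of fun i j : Fin 1 => if i.val + j.val + 1 = 1 then (1 : L) else 0)).Local v)) * h⁻¹ ∈ C → h * (s : ((cmDatum L 2 (Matrix.of fun i j : Fin 2 => if i.val + j.val + 1 = 2 then (1 : L) else 0)).Local v × (cmDatum L 1 (Matrix.of fun i j : Fin 1 => if i.val + j.val + 1 = 1 then (1 : L) else 0)).Local v)) * h⁻¹ ∈ D := by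
  classical
  have hc1 : IsCMField.complexConj L ≠ 1 := IsCMField.complexConj_ne_one L
  -- the one-place model `e : U(Φ₂)_v ≃ₜ* U(σ_w, Φ₂,w)(L_w) ≤ GL₂(L_w)` and the induced map `ψ` on `H_v` (first factor, as a matrix over the FIELD `L_w`)
  set e := localNonsplitEquiv (IsCMField.complexConj L) (Matrix.of fun i j : Fin 2 => if i.val + j.val + 1 = 2 then (1 : L) else 0) hc1 w hw
  set ψ : ((cmDatum L 2 (Matrix.of fun i j : Fin 2 => if i.val + j.val + 1 = 2 then (1 : L) else 0)).Local v × (cmDatum L 1 (Matrix.of fun i j : Fin 1 => if i.val + j.val + 1 = 1 then (1 : L) else 0)).Local v) → GL (Fin 2) (w.1.adicCompletion L) := fun g =>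
    ((e g.1 : ↥(unitaryGroupOfForm (galAdicCompletionMap (L := L) (IsCMField.complexConj L) hw) (placeForm (Matrix.of fun i j : Fin 2 => if i.val + j.val + 1 = 2 then (1 : L) else 0) w.1))) : GL (Fin 2) (w.1.adicCompletion L)) with hψ
  have hψc : Continuous ψ := continuous_subtype_val.comp (e.continuous.comp continuous_fst)
  have hψmul : ∀ a b : ((cmDatum L 2 (Matrix.of fun i j : Fin 2 => if i.val + j.val + 1 = 2 then (1 : L) else 0)).Local v × (cmDatum L 1 (Matrix.of fun i j : Fin 1 => if i.val + j.val + 1 = 1 then (1 : L) else 0)).Local v), ψ (a * b) = ψ a * ψ b := fun a b => by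
    have h1 : e (a * b).1 = e a.1 * e b.1 := map_mul e a.1 b.1
    simp only [hψ, h1, Subgroup.coe_mul]
  have hψinv : ∀ a : ((cmDatum L 2 (Matrix.of fun i j : Fin 2 => if i.val + j.val + 1 = 2 then (1 : L) else 0)).Local v × (cmDatum L 1 (Matrix.of fun i j : Fin 1 => if i.val + j.val + 1 = 1 then (1 : L) else 0)).Local v), ψ a⁻¹ = (ψ a)⁻¹ := fun a => by
    have h1 : e (a⁻¹).1 = (e a.1)⁻¹ := map_inv e a.1
    simp only [hψ, h1, Subgroup.coe_inv]
  -- the torus is locally compact, its regular locus `U` is open; a compact neighbourhood `Kₛ ⊆ U` of `s`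
  haveI : LocallyCompactSpace ↥(Subgroup.centralizer ({t₀} : Set ((cmDatum L 2 (Matrix.of fun i j : Fin 2 => if i.val + j.val + 1 = 2 then (1 : L) else 0)).Local v × (cmDatum L 1 (Matrix.of fun i j : Fin 1 => if i.val + j.val + 1 = 1 then (1 : L) else 0)).Local v))) :=
    (isClosed_coe_centralizer_singleton t₀).isClosedEmbedding_subtypeVal.locallyCompactSpace
  have hUo : IsOpen {x : ↥(Subgroup.centralizer ({t₀} : Set ((cmDatum L 2 (Matrix.of fun i j : Fin 2 => if i.val + j.val + 1 = 2 then (1 : L) else 0)).Local v × (cmDatum L 1 (Matrix.of fun i j : Fin 1 => if i.val + j.val + 1 = 1 then (1 : L) else 0)).Local v))) | IsRegularElt ((x : ((cmDatum L 2 (Matrix.of fun i j : Fin 2 => if i.val + j.val + 1 = 2 then (1 : L) else 0)).Local v × (cmDatum L 1 (Matrix.of fun i j : Fin 1 => if i.val + j.val + 1 = 1 then (1 : L) else 0)).Local v)).1.val : GL (Fin 2) (LocalRing L v))} :=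
    (isOpen_setOf_isRegularElt_local_of_nonsplit (IsCMField.complexConj L) 2 (Matrix.of fun i j : Fin 2 => if i.val + j.val + 1 = 2 then (1 : L) else 0) hc1 w hw).preimage
      (continuous_fst.comp continuous_subtype_val)
  obtain ⟨Kₛ, hKₛc, hsK, hKU⟩ := exists_compact_subset hUo hs
  -- Harish-Chandra's straightening in `GL₂(L_w)` at `γ := ψ s`, on `K' := ψ '' Kₛ`, `C' := ψ '' C`
  have hZeq : Subgroup.centralizer ({(s : ((cmDatum L 2 (Matrix.of fun i j : Fin 2 => if i.val + j.val + 1 = 2 then (1 : L) else 0)).Local v × (cmDatum L 1 (Matrix.of fun i j : Fin 1 => if i.val + j.val + 1 = 1 then (1 : L) else 0)).Local v)).1} : Set ((cmDatum L 2 (Matrix.of fun i j : Fin 2 => if i.val + j.val + 1 = 2 then (1 : L) else 0)).Local v)) = Subgroup.centralizer ({t₀.1} : Set ((cmDatum L 2 (Matrix.of fun i j : Fin 2 => if i.val + j.val + 1 = 2 then (1 : L) else 0)).Local v)) := by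
    have hs1 : (s : ((cmDatum L 2 (Matrix.of fun i j : Fin 2 => if i.val + j.val + 1 = 2 then (1 : L) else 0)).Local v × (cmDatum L 1 (Matrix.of fun i j : Fin 1 => if i.val + j.val + 1 = 1 then (1 : L) else 0)).Local v)).1 ∈ Subgroup.centralizer ({t₀.1} : Set ((cmDatum L 2 (Matrix.of fun i j : Fin 2 => if i.val + j.val + 1 = 2 then (1 : L) else 0)).Local v)) :=
      Subgroup.mem_centralizer_singleton_iff.2 (congrArg Prod.fst (Subgroup.mem_centralizer_singleton_iff.1 s.2))
    exact centralizer_eq_centralizer_of_isRegularElt_local_of_nonsplit (IsCMField.complexConj L) 2 (Matrix.of fun i j : Fin 2 => if i.val + j.val + 1 = 2 then (1 : L) else 0) hc1 w hw ht₀ hs hs1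
  have hKc : ∀ t' ∈ (fun x : ↥(Subgroup.centralizer ({t₀} : Set ((cmDatum L 2 (Matrix.of fun i j : Fin 2 => if i.val + j.val + 1 = 2 then (1 : L) else 0)).Local v × (cmDatum L 1 (Matrix.of fun i j : Fin 1 => if i.val + j.val + 1 = 1 then (1 : L) else 0)).Local v))) => ψ (x : ((cmDatum L 2 (Matrix.of fun i j : Fin 2 => if i.val + j.val + 1 = 2 then (1 : L) else 0)).Local v × (cmDatum L 1 (Matrix.of fun i j : Fin 1 => if i.val + j.val + 1 = 1 then (1 : L) else 0)).Local v))) '' Kₛ,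
      Commute (t' : Matrix (Fin 2) (Fin 2) (w.1.adicCompletion L)) (ψ (s : ((cmDatum L 2 (Matrix.of fun i j : Fin 2 => if i.val + j.val + 1 = 2 then (1 : L) else 0)).Local v × (cmDatum L 1 (Matrix.of fun i j : Fin 1 => if i.val + j.val + 1 = 1 then (1 : L) else 0)).Local v)) : Matrix (Fin 2) (Fin 2) (w.1.adicCompletion L)) := by
    rintro _ ⟨x, -, rfl⟩
    have hx1 : (x : ((cmDatum L 2 (Matrix.of fun i j : Fin 2 => if i.val + j.val + 1 = 2 then (1 : L) else 0)).Local v × (cmDatum L 1 (Matrix.of fun i j : Fin 1 => if i.val + j.val + 1 = 1 then (1 : L) else 0)).Local v)).1 ∈ Subgroup.centralizer ({(s : ((cmDatum L 2 (Matrix.of fun i j : Fin 2 => if i.val + j.val + 1 = 2 then (1 : L) else 0)).Local v × (cmDatum L 1 (Matrix.of fun i j : Fin 1 => if i.val + j.val + 1 = 1 then (1 : L) else 0)).Local v)).1} : Set ((cmDatum L 2 (Matrix.of fun i j : Fin 2 => if i.val + j.val + 1 = 2 then (1 : L) else 0)).Local v)) := by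
      rw [hZeq]
      exact Subgroup.mem_centralizer_singleton_iff.2 (congrArg Prod.fst (Subgroup.mem_centralizer_singleton_iff.1 x.2))
    have hxs : (x : ((cmDatum L 2 (Matrix.of fun i j : Fin 2 => if i.val + j.val + 1 = 2 then (1 : L) else 0)).Local v × (cmDatum L 1 (Matrix.of fun i j : Fin 1 => if i.val + j.val + 1 = 1 then (1 : L) else 0)).Local v)).1 * (s : ((cmDatum L 2 (Matrix.of fun i j : Fin 2 => if i.val + j.val + 1 = 2 then (1 : L) else 0)).Local v × (cmDatum L 1 (Matrix.of fun i j : Fin 1 => if i.val + j.val + 1 = 1 then (1 : L) else 0)).Local v)).1 = (s : ((cmDatum L 2 (Matrix.of fun i j : Fin 2 => if i.val + j.val + 1 = 2 then (1 : L) else 0)).Local v × (cmDatum L 1 (Matrix.of fun i j : Fin 1 => if i.val + j.val + 1 = 1 then (1 : L) else 0)).Local v)).1 * (x : ((cmDatum L 2 (Matrix.of fun i j : Fin 2 => if i.val + j.val + 1 = 2 then (1 : L) else 0)).Local v × (cmDatum L 1 (Matrix.of fun i j : Fin 1 => if i.val + j.val + 1 = 1 then (1 : L) else 0)).Local v)).1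 := Subgroup.mem_centralizer_singleton_iff.1 hx1
    have h2 : ψ ((x : ((cmDatum L 2 (Matrix.of fun i j : Fin 2 => if i.val + j.val + 1 = 2 then (1 : L) else 0)).Local v × (cmDatum L 1 (Matrix.of fun i j : Fin 1 => if i.val + j.val + 1 = 1 then (1 : L) else 0)).Local v)) * (s : ((cmDatum L 2 (Matrix.of fun i j : Fin 2 => if i.val + j.val + 1 = 2 then (1 : L) else 0)).Local v × (cmDatum L 1 (Matrix.of fun i j : Fin 1 => if i.val + j.val + 1 = 1 then (1 : L) else 0)).Local v))) = ψ ((s : ((cmDatum L 2 (Matrix.of fun i j : Fin 2 => if i.val + j.val + 1 = 2 then (1 : L) else 0)).Local v × (cmDatum L 1 (Matrix.of fun i j : Fin 1 => if i.val + j.val + 1 = 1 then (1 : L) else 0)).Local v)) * (x : ((cmDatum L 2 (Matrix.of fun i j : Fin 2 => if i.val + j.val + 1 = 2 then (1 : L) else 0)).Local v × (cmDatum L 1 (Matrix.of fun i j : Fin 1 => if i.val + j.val + 1 = 1 then (1 : L) else 0)).Local v))) :=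
      congrArg (fun u : ((cmDatum L 2 (Matrix.of fun i j : Fin 2 => if i.val + j.val + 1 = 2 then (1 : L) else 0)).Local v) => ((e u : ↥(unitaryGroupOfForm (galAdicCompletionMap (L := L) (IsCMField.complexConj L) hw) (placeForm (Matrix.of fun i j : Fin 2 => if i.val + j.val + 1 = 2 then (1 : L) else 0) w.1))) :
        GL (Fin 2) (w.1.adicCompletion L))) hxs
    rw [hψmul, hψmul] at h2
    exact congrArg Units.val h2
  have hKreg : ∀ t' ∈ (fun x : ↥(Subgroup.centralizer ({t₀} : Set ((cmDatum L 2 (Matrix.of fun i j : Fin 2 => if i.val + j.val + 1 = 2 then (1 : L) else 0)).Local v × (cmDatum L 1 (Matrix.of fun i j : Fin 1 => if i.val + j.val + 1 = 1 then (1 : L) else 0)).Local v))) => ψ (x : ((cmDatum L 2 (Matrix.of fun i j : Fin 2 => if i.val + j.val + 1 = 2 then (1 : L) else 0)).Local v × (cmDatum L 1 (Matrix.of fun i j : Fin 1 => if i.val + j.val + 1 = 1 then (1 : L) else 0)).Local v))) '' Kₛ,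
      ((t' : Matrix (Fin 2) (Fin 2) (w.1.adicCompletion L)).charpoly).Separable := by
    rintro _ ⟨x, hx, rfl⟩
    exact charpoly_separable_localNonsplitEquiv_of_isRegularElt (IsCMField.complexConj L) 2 (Matrix.of fun i j : Fin 2 => if i.val + j.val + 1 = 2 then (1 : L) else 0) hc1 (x : ((cmDatum L 2 (Matrix.of fun i j : Fin 2 => if i.val + j.val + 1 = 2 then (1 : L) else 0)).Local v × (cmDatum L 1 (Matrix.of fun i j : Fin 1 => if i.val + j.val + 1 = 1 then (1 : L) else 0)).Local v)).1 w hw (hKU hx)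
  have hγ : ((ψ (s : ((cmDatum L 2 (Matrix.of fun i j : Fin 2 => if i.val + j.val + 1 = 2 then (1 : L) else 0)).Local v × (cmDatum L 1 (Matrix.of fun i j : Fin 1 => if i.val + j.val + 1 = 1 then (1 : L) else 0)).Local v)) : Matrix (Fin 2) (Fin 2) (w.1.adicCompletion L)).charpoly).Separable :=
    charpoly_separable_localNonsplitEquiv_of_isRegularElt (IsCMField.complexConj L) 2 (Matrix.of fun i j : Fin 2 => if i.val + j.val + 1 = 2 then (1 : L) else 0) hc1 (s : ((cmDatum L 2 (Matrix.of fun i j : Fin 2 => if i.val + j.val + 1 = 2 then (1 : L) else 0)).Local v × (cmDatum L 1 (Matrix.of fun i j : Fin 1 => if i.val + j.val + 1 = 1 then (1 : L) else 0)).Local v)).1 w hw hs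
  obtain ⟨D', hD'c, hD'⟩ := GL.exists_isCompact_forall_conj_mem_of_charpoly_separable (ψ (s : ((cmDatum L 2 (Matrix.of fun i j : Fin 2 => if i.val + j.val + 1 = 2 then (1 : L) else 0)).Local v × (cmDatum L 1 (Matrix.of fun i j : Fin 1 => if i.val + j.val + 1 = 1 then (1 : L) else 0)).Local v))) hγ
    (hKₛc.image (hψc.comp continuous_subtype_val)) hKc hKreg (hC.image hψc)
  -- `D := ψ ⁻¹' D'` is compact: `U(σ_w, Φ₂,w)` is closed in `GL₂(L_w)`, `e` is a homeomorphism, `U(Φ₁)_v` is compact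
  haveI : CompactSpace ((cmDatum L 1 (Matrix.of fun i j : Fin 1 => if i.val + j.val + 1 = 1 then (1 : L) else 0)).Local v) := compactSpace_cmDatum_local_one_of_smul_eq L v w hw
  have hval : IsCompact ((Subtype.val : ↥(unitaryGroupOfForm (galAdicCompletionMap (L := L) (IsCMField.complexConj L) hw) (placeForm (Matrix.of fun i j : Fin 2 => if i.val + j.val + 1 = 2 then (1 : L) else 0) w.1)) →
      GL (Fin 2) (w.1.adicCompletion L)) ⁻¹' D') :=
    (isClosed_unitaryGroupOfForm (continuous_galAdicCompletionMap (L := L) (IsCMField.complexConj L) hw)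
      (placeForm (Matrix.of fun i j : Fin 2 => if i.val + j.val + 1 = 2 then (1 : L) else 0) w.1)).isClosedEmbedding_subtypeVal.isCompact_preimage hD'c
  have h2 : IsCompact ((fun g₂ : ((cmDatum L 2 (Matrix.of fun i j : Fin 2 => if i.val + j.val + 1 = 2 then (1 : L) else 0)).Local v) => e g₂) ⁻¹' ((Subtype.val : ↥(unitaryGroupOfForm (galAdicCompletionMap (L := L) (IsCMField.complexConj L) hw) (placeForm (Matrix.of fun i j : Fin 2 => if i.val + j.val + 1 = 2 then (1 : L) else 0) w.1)) →
      GL (Fin 2) (w.1.adicCompletion L)) ⁻¹' D')) :=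
    e.toHomeomorph.isCompact_preimage.2 hval
  have hset : ψ ⁻¹' D' = ((fun g₂ : ((cmDatum L 2 (Matrix.of fun i j : Fin 2 => if i.val + j.val + 1 = 2 then (1 : L) else 0)).Local v) => e g₂) ⁻¹' ((Subtype.val : ↥(unitaryGroupOfForm (galAdicCompletionMap (L := L) (IsCMField.complexConj L) hw) (placeForm (Matrix.of fun i j : Fin 2 => if i.val + j.val + 1 = 2 then (1 : L) else 0) w.1)) →
      GL (Fin 2) (w.1.adicCompletion L)) ⁻¹' D')) ×ˢ (Set.univ : Set ((cmDatum L 1 (Matrix.of fun i j : Fin 1 => if i.val + j.val + 1 = 1 then (1 : L) else 0)).Local v)) := by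
    ext g
    simp only [hψ, Set.mem_preimage, Set.mem_prod, Set.mem_univ, and_true]
  refine ⟨ψ ⁻¹' D', by rw [hset]; exact h2.prod isCompact_univ, ?_⟩
  -- near `s`: `t ∈ Kₛ`
  filter_upwards [mem_interior_iff_mem_nhds.1 hsK] with x hx h hmem
  have key := hD' (ψ (x : ((cmDatum L 2 (Matrix.of fun i j : Fin 2 => if i.val + j.val + 1 = 2 then (1 : L) else 0)).Local v × (cmDatum L 1 (Matrix.of fun i j : Fin 1 => if i.val + j.val + 1 = 1 then (1 : L) else 0)).Local v))) ⟨x, hx, rfl⟩ (ψ h) (by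
    rw [← hψinv, ← hψmul, ← hψmul]
    exact ⟨_, hmem, rfl⟩)
  show ψ (h * (s : ((cmDatum L 2 (Matrix.of fun i j : Fin 2 => if i.val + j.val + 1 = 2 then (1 : L) else 0)).Local v × (cmDatum L 1 (Matrix.of fun i j : Fin 1 => if i.val + j.val + 1 = 1 then (1 : L) else 0)).Local v)) * h⁻¹) ∈ D'
  rw [hψmul, hψmul, hψinv]
  exact key

/-- **LOCAL CONSTANCY ALONG THE TORUS (with a reparametrised conjugating variable).**  For `f : H_v → V` locally constant with compact support, an elliptic regular frame
`(t₀, P, d)`, `s ∈ Z(t₀)` with `s.1` regular, ANY measure `ν` on any `Ω` and any `φ : Ω → H_v`:  `∫ f(φ ω · t · (φ ω)⁻¹) dν(ω) = ∫ f(φ ω · s · (φ ω)⁻¹) dν(ω)` for all `t ∈ Z(t₀)`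
near `s`. [cite: HarishChandra1970, Part I §3 Lemmas 14, 20] [cite: Rogawski1990, §4.9 p. 54] -/
theorem eventually_integral_conj_comp_eq_of_mem_centralizer {Ω : Type*} [MeasurableSpace Ω] (ν : Measure Ω) (φ : Ω → ((cmDatum L 2 (Matrix.of fun i j : Fin 2 => if i.val + j.val + 1 = 2 then (1 : L) else 0)).Local v × (cmDatum L 1 (Matrix.of fun i j : Fin 1 => if i.val + j.val + 1 = 1 then (1 : L) else 0)).Local v))
    {V : Type*} [NormedAddCommGroup V] [NormedSpace ℝ V] {f : ((cmDatum L 2 (Matrix.of fun i j : Fin 2 => if i.val + j.val + 1 = 2 then (1 : L) else 0)).Local v × (cmDatum L 1 (Matrix.of fun i j : Fin 1 => if i.val + j.val + 1 = 1 then (1 : L) else 0)).Local v) → V} (hf : IsLocallyConstant f) (hfc : HasCompactSupport f)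
    (t₀ : ((cmDatum L 2 (Matrix.of fun i j : Fin 2 => if i.val + j.val + 1 = 2 then (1 : L) else 0)).Local v × (cmDatum L 1 (Matrix.of fun i j : Fin 1 => if i.val + j.val + 1 = 1 then (1 : L) else 0)).Local v)) (P : GL (Fin 2) (LocalRing L v)) (d : Fin 2 → (LocalRing L v)) (ht₀ : IsRegularElt (t₀.1.val : GL (Fin 2) (LocalRing L v)))
    (hP : (t₀.1.val.val : Matrix (Fin 2) (Fin 2) (LocalRing L v)) * P.val = P.val * Matrix.diagonal d) (hd1 : ∀ i, conjLocal L (IsCMField.complexConj L) v (d i) * d i = 1)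
    (s : ↥(Subgroup.centralizer ({t₀} : Set ((cmDatum L 2 (Matrix.of fun i j : Fin 2 => if i.val + j.val + 1 = 2 then (1 : L) else 0)).Local v × (cmDatum L 1 (Matrix.of fun i j : Fin 1 => if i.val + j.val + 1 = 1 then (1 : L) else 0)).Local v)))) (hs : IsRegularElt ((s : ((cmDatum L 2 (Matrix.of fun i j : Fin 2 => if i.val + j.val + 1 = 2 then (1 : L) else 0)).Local v × (cmDatum L 1 (Matrix.of fun i j : Fin 1 => if i.val + j.val + 1 = 1 then (1 : L) else 0)).Local v)).1.val : GL (Fin 2) (LocalRing L v))) :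
    ∀ᶠ t : ↥(Subgroup.centralizer ({t₀} : Set ((cmDatum L 2 (Matrix.of fun i j : Fin 2 => if i.val + j.val + 1 = 2 then (1 : L) else 0)).Local v × (cmDatum L 1 (Matrix.of fun i j : Fin 1 => if i.val + j.val + 1 = 1 then (1 : L) else 0)).Local v))) in 𝓝 s,
      ∫ ω, f (φ ω * (t : ((cmDatum L 2 (Matrix.of fun i j : Fin 2 => if i.val + j.val + 1 = 2 then (1 : L) else 0)).Local v × (cmDatum L 1 (Matrix.of fun i j : Fin 1 => if i.val + j.val + 1 = 1 then (1 : L) else 0)).Local v)) * (φ ω)⁻¹) ∂ν = ∫ ω, f (φ ω * (s : ((cmDatum L 2 (Matrix.of fun i j : Fin 2 => if i.val + j.val + 1 = 2 then (1 : L) else 0)).Local v × (cmDatum L 1 (Matrix.of fun i j : Fin 1 => if i.val + j.val + 1 = 1 then (1 : L) else 0)).Local v)) * (φ ω)⁻¹) ∂ν := by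
  obtain ⟨D, hDc, hD⟩ := exists_isCompact_forall_eventually_conj_mem L v w hw t₀ ht₀ s hs hfc.isCompact
  refine eventually_integral_conj_eq_of_straightening ν φ hf continuous_subtype_val s
    (isCompact_setOf_conj_mem_of_mem_centralizer_of_isRegularElt L v w hw t₀ P d ht₀ hP hd1 (s : ((cmDatum L 2 (Matrix.of fun i j : Fin 2 => if i.val + j.val + 1 = 2 then (1 : L) else 0)).Local v × (cmDatum L 1 (Matrix.of fun i j : Fin 1 => if i.val + j.val + 1 = 1 then (1 : L) else 0)).Local v)) s.2 hs hDc) ?_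
  exact hD.mono fun x hx h hne => hx h (subset_tsupport _ (Function.mem_support.2 hne))

variable [MeasurableSpace ((cmDatum L 2 (Matrix.of fun i j : Fin 2 => if i.val + j.val + 1 = 2 then (1 : L) else 0)).Local v × (cmDatum L 1 (Matrix.of fun i j : Fin 1 => if i.val + j.val + 1 = 1 then (1 : L) else 0)).Local v)]

/-- **LOCAL CONSTANCY OF THE PLAIN ORBITAL INTEGRAL ALONG AN ELLIPTIC TORUS AT ITS `H`-REGULAR POINTS**: `∫ f(h t h⁻¹) dν(h) = ∫ f(h s h⁻¹) dν(h)` for `t ∈ Z(t₀)` near `s`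
(`ν` ANY measure on `H_v` — e.g. a Haar measure, for which these are the orbital integrals at compact-centraliser classes). [cite: HarishChandra1970, Part I §3 Lemmas 14, 20]
[cite: Rogawski1990, §4.9 p. 54; §4.3 (4.3.1) p. 43] -/
theorem eventually_integral_conj_eq_of_mem_centralizer (ν : Measure ((cmDatum L 2 (Matrix.of fun i j : Fin 2 => if i.val + j.val + 1 = 2 then (1 : L) else 0)).Local v × (cmDatum L 1 (Matrix.of fun i j : Fin 1 => if i.val + j.val + 1 = 1 then (1 : L) else 0)).Local v))
    {V : Type*} [NormedAddCommGroup V] [NormedSpace ℝ V] {f : ((cmDatum L 2 (Matrix.of fun i j : Fin 2 => if i.val + j.val + 1 = 2 then (1 : L) else 0)).Local v × (cmDatum L 1 (Matrix.of fun i j : Fin 1 => if i.val + j.val + 1 = 1 then (1 : L) else 0)).Local v) → V} (hf : IsLocallyConstant f) (hfc : HasCompactSupport f)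
    (t₀ : ((cmDatum L 2 (Matrix.of fun i j : Fin 2 => if i.val + j.val + 1 = 2 then (1 : L) else 0)).Local v × (cmDatum L 1 (Matrix.of fun i j : Fin 1 => if i.val + j.val + 1 = 1 then (1 : L) else 0)).Local v)) (P : GL (Fin 2) (LocalRing L v)) (d : Fin 2 → (LocalRing L v)) (ht₀ : IsRegularElt (t₀.1.val : GL (Fin 2) (LocalRing L v)))
    (hP : (t₀.1.val.val : Matrix (Fin 2) (Fin 2) (LocalRing L v)) * P.val = P.val * Matrix.diagonal d) (hd1 : ∀ i, conjLocal L (IsCMField.complexConj L) v (d i) * d i = 1)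
    (s : ↥(Subgroup.centralizer ({t₀} : Set ((cmDatum L 2 (Matrix.of fun i j : Fin 2 => if i.val + j.val + 1 = 2 then (1 : L) else 0)).Local v × (cmDatum L 1 (Matrix.of fun i j : Fin 1 => if i.val + j.val + 1 = 1 then (1 : L) else 0)).Local v)))) (hs : IsRegularElt ((s : ((cmDatum L 2 (Matrix.of fun i j : Fin 2 => if i.val + j.val + 1 = 2 then (1 : L) else 0)).Local v × (cmDatum L 1 (Matrix.of fun i j : Fin 1 => if i.val + j.val + 1 = 1 then (1 : L) else 0)).Local v)).1.val : GL (Fin 2) (LocalRing L v))) :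
    ∀ᶠ t : ↥(Subgroup.centralizer ({t₀} : Set ((cmDatum L 2 (Matrix.of fun i j : Fin 2 => if i.val + j.val + 1 = 2 then (1 : L) else 0)).Local v × (cmDatum L 1 (Matrix.of fun i j : Fin 1 => if i.val + j.val + 1 = 1 then (1 : L) else 0)).Local v))) in 𝓝 s,
      ∫ h, f (h * (t : ((cmDatum L 2 (Matrix.of fun i j : Fin 2 => if i.val + j.val + 1 = 2 then (1 : L) else 0)).Local v × (cmDatum L 1 (Matrix.of fun i j : Fin 1 => if i.val + j.val + 1 = 1 then (1 : L) else 0)).Local v)) * h⁻¹) ∂ν = ∫ h, f (h * (s : ((cmDatum L 2 (Matrix.of fun i j : Fin 2 => if i.val + j.val + 1 = 2 then (1 : L) else 0)).Local v × (cmDatum L 1 (Matrix.of fun i j : Fin 1 => if i.val + j.val + 1 = 1 then (1 : L) else 0)).Local v)) * h⁻¹) ∂ν :=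
  eventually_integral_conj_comp_eq_of_mem_centralizer L v w hw ν id hf hfc t₀ P d ht₀ hP hd1 s hs

/-- **TRANSPORTED FORM (the stable partner's torus)**: for a topological-group automorphism `e` of `H_v`, `∫ f(h · e t · h⁻¹) dν(h) = ∫ f(h · e s · h⁻¹) dν(h)` for `t ∈ Z(t₀)` near `s`
(the previous theorem for `f ∘ e` with the conjugating variable `e.symm h`). [cite: HarishChandra1970, Part I §3 Lemmas 14, 20] [cite: LabesseLanglands1979, §2] -/
theorem eventually_integral_conj_mulEquiv_eq_of_mem_centralizer (ν : Measure ((cmDatum L 2 (Matrix.of fun i j : Fin 2 => if i.val + j.val + 1 = 2 then (1 : L) else 0)).Local v × (cmDatum L 1 (Matrix.of fun i j : Fin 1 => if i.val + j.val + 1 = 1 then (1 : L) else 0)).Local v))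
    {V : Type*} [NormedAddCommGroup V] [NormedSpace ℝ V] {f : ((cmDatum L 2 (Matrix.of fun i j : Fin 2 => if i.val + j.val + 1 = 2 then (1 : L) else 0)).Local v × (cmDatum L 1 (Matrix.of fun i j : Fin 1 => if i.val + j.val + 1 = 1 then (1 : L) else 0)).Local v) → V} (hf : IsLocallyConstant f) (hfc : HasCompactSupport f)
    (t₀ : ((cmDatum L 2 (Matrix.of fun i j : Fin 2 => if i.val + j.val + 1 = 2 then (1 : L) else 0)).Local v × (cmDatum L 1 (Matrix.of fun i j : Fin 1 => if i.val + j.val + 1 = 1 then (1 : L) else 0)).Local v)) (P : GL (Fin 2) (LocalRing L v)) (d : Fin 2 → (LocalRing L v)) (ht₀ : IsRegularElt (t₀.1.val : GL (Fin 2) (LocalRing L v)))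
    (hP : (t₀.1.val.val : Matrix (Fin 2) (Fin 2) (LocalRing L v)) * P.val = P.val * Matrix.diagonal d) (hd1 : ∀ i, conjLocal L (IsCMField.complexConj L) v (d i) * d i = 1)
    (e : ((cmDatum L 2 (Matrix.of fun i j : Fin 2 => if i.val + j.val + 1 = 2 then (1 : L) else 0)).Local v × (cmDatum L 1 (Matrix.of fun i j : Fin 1 => if i.val + j.val + 1 = 1 then (1 : L) else 0)).Local v) ≃ₜ* ((cmDatum L 2 (Matrix.of fun i j : Fin 2 => if i.val + j.val + 1 = 2 then (1 : L) else 0)).Local v × (cmDatum L 1 (Matrix.of fun i j : Fin 1 => if i.val + j.val + 1 = 1 then (1 : L) else 0)).Local v))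
    (s : ↥(Subgroup.centralizer ({t₀} : Set ((cmDatum L 2 (Matrix.of fun i j : Fin 2 => if i.val + j.val + 1 = 2 then (1 : L) else 0)).Local v × (cmDatum L 1 (Matrix.of fun i j : Fin 1 => if i.val + j.val + 1 = 1 then (1 : L) else 0)).Local v)))) (hs : IsRegularElt ((s : ((cmDatum L 2 (Matrix.of fun i j : Fin 2 => if i.val + j.val + 1 = 2 then (1 : L) else 0)).Local v × (cmDatum L 1 (Matrix.of fun i j : Fin 1 => if i.val + j.val + 1 = 1 then (1 : L) else 0)).Local v)).1.val : GL (Fin 2) (LocalRing L v))) :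
    ∀ᶠ t : ↥(Subgroup.centralizer ({t₀} : Set ((cmDatum L 2 (Matrix.of fun i j : Fin 2 => if i.val + j.val + 1 = 2 then (1 : L) else 0)).Local v × (cmDatum L 1 (Matrix.of fun i j : Fin 1 => if i.val + j.val + 1 = 1 then (1 : L) else 0)).Local v))) in 𝓝 s,
      ∫ h, f (h * e (t : ((cmDatum L 2 (Matrix.of fun i j : Fin 2 => if i.val + j.val + 1 = 2 then (1 : L) else 0)).Local v × (cmDatum L 1 (Matrix.of fun i j : Fin 1 => if i.val + j.val + 1 = 1 then (1 : L) else 0)).Local v)) * h⁻¹) ∂ν = ∫ h, f (h * e (s : ((cmDatum L 2 (Matrix.of fun i j : Fin 2 => if i.val + j.val + 1 = 2 then (1 : L) else 0)).Local v × (cmDatum L 1 (Matrix.of fun i j : Fin 1 => if i.val + j.val + 1 = 1 then (1 : L) else 0)).Local v)) * h⁻¹) ∂ν := by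
  have key := eventually_integral_conj_comp_eq_of_mem_centralizer L v w hw ν (fun h : ((cmDatum L 2 (Matrix.of fun i j : Fin 2 => if i.val + j.val + 1 = 2 then (1 : L) else 0)).Local v × (cmDatum L 1 (Matrix.of fun i j : Fin 1 => if i.val + j.val + 1 = 1 then (1 : L) else 0)).Local v) => e.symm h) (f := f ∘ e)
    (hf.comp_continuous e.continuous) (hfc.comp_homeomorph e.toHomeomorph) t₀ P d ht₀ hP hd1 s hs
  refine key.mono fun t ht => ?_
  simpa only [Function.comp_apply, map_mul, map_inv, ContinuousMulEquiv.apply_symm_apply] using ht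

end LocalH

end Literature.NumberTheory.Rogawski1990

end
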